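import Literature.AlgebraicGeometry.ModuliOfAbelianVarieties.SiegelFamilyShimuraLocusGenericDense
import Literature.NumberTheory.ModularForms.SiegelUpperHalfSpaceProperAction
import HarnessLib

/-!
# Shimura's Theorem 2 ON the locus: the points `Z ∈ 𝔜_j` with `End(X_Z) = ℤ`, `(X_Z, E_Z) ≅ (X_{−Z̄}, E_{−Z̄})`
# and no real structure are DENSE in `𝔥_g ∩ 𝔜_j` — «`𝔜` cannot be covered by `∪_{f ∈ S′} X_f`»
# (Shimura 1972, §3 Prop. 11 and Thm. 2)

Topic `Literature/AlgebraicGeometry/ModuliOfAbelianVarieties` (the Siegel-family files, namespace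
`Literature.AlgebraicGeometry.ModuliOfAbelianVarieties.SiegelModuli`).  Lane `lit-hodgefound`
(Track 2 foundations library), prover seat p15 generation 49, row g49-#7, on top of g48-#6 (the sweep,
genericity transfer and tests for the parametrization `x = A + ᵗA`, `y = ᵗBB + 1`), g49-#1 (the commutant
of `Sym_j` for every `j`; the sweep is onto `𝔜_j`) and g49-#2 (algebraically independent parameters are
dense in `ℝ^{2g²}`).  g48-#6's parametrization `y = ᵗBB + 1` reaches only the points of `𝔜_j` with
`y ⪰ 1`; to transport density from the parameter space to ALL of `𝔜_j` THIS FILE redoes §2–§3 of g48-#6 for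
the LINEAR sweep `x = A + ᵗA`, `y = B + ᵗB` (which is onto `{(x, y) : ᵗx = x, ᵗy = y}`, positivity being an
open condition), and concludes: the generic points are dense in `𝔥_g ∩ 𝔜_j` — the honest content of «`𝔜`
cannot be covered by `∪_{f ∈ S′} X_f`» (each `X_f` closed with empty interior in `𝔜`).  THEOREMS ONLY: no
definition, no instance, no notation, no named fact (net Literature debt `0`), no `sorry`.

## Source, VERBATIM

G. Shimura, *On the field of rationality for an abelian variety*, Nagoya Math. J. **45** (1972) 167–178,
held `paper:doi-10-1017-s0027763000014720`, §3 pp. 175–177: «**PROPOSITION 11.** The set `𝔜` of Prop. 10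
is non-empty.  Moreover, let `g` be a holomorphic function defined on a connected domain `D` contained in
`𝔖_n`.  If `g = 0` on a non-empty open subset of `D ∩ 𝔜`, then `g` is identically `0` on `D`.»
«**THEOREM 2.** … it is sufficient to find a generic `P_z` with `z` in `𝔜`. … Put, for each `f ∈ S′`,
`X_f = {z ∈ 𝔜 : f(φ(z)) = 0}`.  Then `X_f` is a closed subset of `𝔜`, which contains no non-empty open
subset of `𝔜` by Prop. 11.  Since `S′` is a countable set, `𝔜` cannot be covered by `∪_{f ∈ S′} X_f`.
Therefore `𝔜` has a point `z` for which `f(φ(z)) ≠ 0` for all `f ∈ S′`.  Then `φ(z)` is generic on `V`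
over `ℚ`, q.e.d.»

## The tree's rendering

* **§1–§2 The linear sweep** `Z_L(A, B) = (x + jxj) + i(y − jyj)`, `x = A + ᵗA`, `y = B + ᵗB`: the
  genericity transfer (`linSweep_rel_forall`: a period relation `(Zβ + δ)Z = Zα + γ` at a point with
  algebraically independent real `(A, B)` holds at `Z_L(A′, B′)` for all complex `A′, B′`) and the tests
  (`blocks_of_linSweep_rel`: `Z′ = 0, ±2i·1` (`A′ = 0`, `B′ = 0, ±¼·… `) and `Z′ = S` give `β = γ = 0`,
  `α = δ`, `δ ∈ Sym_j′`), verbatim the mechanism of g48-#6 for the new parametrization.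
* **§3 Thm. 2 at the linear-sweep point**: for `v = (A, B)` algebraically independent with `Z_L(v) ∈ 𝔥_g`:
  `End(X_Z) = ℤ` (`linSweepPoint_end_eq_smul_one`, commutant from g49-#1), `End^* = {±1}`, and
  `(X_Z, E_Z) ≅ (X_{−Z̄}, E_{−Z̄})`, `X_Z ≅` every conjugate presentation, `IsEmpty (RealStructure X_Z)`
  (`linSweepPoint_isPolarizedIso_conj_and_isEmpty_realStructure`).
* **§4 Onto and continuous**: every `Z ∈ 𝔥_g ∩ 𝔜_j` is `Z_L(Re Z/4, Im Z/4)` (`exists_linSweepPoint_eq_of_locus`,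
  from g49-#1 `exists_sweep_eq_of_locus`), and `v ↦ Z_L(v)` is continuous (`continuous_linSweepPoint`).
* **§5 «`𝔜` cannot be covered by `∪ X_f`»: density ON the locus** (`locus_subset_closure_generic`): every
  point of `𝔥_g ∩ 𝔜_j` is a limit of points `Z ∈ 𝔥_g ∩ 𝔜_j` with `End(X_Z) = ℤ`,
  `(X_Z, E_Z) ≅ (X_{−Z̄}, E_{−Z̄})` and no real structure — the algebraically independent parameters are
  dense (g49-#2), positivity of `Im Z_L(v)` is open, and `Z_L` is continuous and onto.
-/

noncomputable section

open scoped Manifold Matrix ComplexConjugate Topology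
open Matrix Complex Function Set Filter

namespace Literature.AlgebraicGeometry.ModuliOfAbelianVarieties

namespace SiegelModuli

open Literature.NumberTheory.Automorphic (siegelUpperHalfSpace)
open Literature.NumberTheory.ModularForms.SiegelUpperHalfSpace (isOpen_setOf_im_pos siegelUpperHalfSpace_eq_inter)
open Literature.Geometry.Kaehler Literature.Geometry.Kaehler.ComplexTorus

variable {g : ℕ}

/-! ## §0 Small matrix helpers -/

/-- `(A_S)` mapped along a ring homomorphism `S → T` is `A_T`. [folklore] -/
private theorem map_intCast_map_g49g {m n S T F : Type*} [Ring S] [Ring T] [FunLike F S T]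
    [RingHomClass F S T] (f : F) (A : Matrix m n ℤ) :
    (A.map (Int.cast : ℤ → S)).map f = A.map (Int.cast : ℤ → T) := by
  ext i k
  simp [Matrix.map_apply]

/-- Products of integer matrices cast to a ring. [folklore] -/
private theorem map_intCast_mul_g49g {l m n R : Type*} [Fintype m] [Ring R] (A : Matrix l m ℤ)
    (B : Matrix m n ℤ) : (A * B).map (Int.cast : ℤ → R) = A.map (Int.cast : ℤ → R) * B.map (Int.cast : ℤ → R) :=
  Matrix.map_mul (f := Int.castRingHom R)

/-- The integer cast of matrices is injective. [folklore] -/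
private theorem map_intCast_injective_g49g {m n R : Type*} [AddGroupWithOne R] [CharZero R] :
    Function.Injective fun A : Matrix m n ℤ ↦ A.map (Int.cast : ℤ → R) := fun A B h ↦ by
  ext i k
  have := congrFun (congrFun h i) k
  simpa [Matrix.map_apply] using this

/-- Negation commutes with the integer cast of matrices. [folklore] -/
private theorem map_intCast_neg_g49g {m n R : Type*} [Ring R] (A : Matrix m n ℤ) :
    (-A).map (Int.cast : ℤ → R) = -A.map (Int.cast : ℤ → R) := by
  ext i k
  simp [Matrix.map_apply]

/-- `j² = −1` survives the cast to any ring. [folklore] -/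
private theorem map_intCast_mul_self_eq_neg_one_g49g {n : ℕ} {R : Type*} [Ring R] {j : Matrix (Fin n) (Fin n) ℤ}
    (hjj : j * j = -1) : j.map (Int.cast : ℤ → R) * j.map (Int.cast : ℤ → R) = -1 := by
  rw [← map_intCast_mul_g49g, hjj, map_intCast_neg_g49g, Matrix.map_one Int.cast Int.cast_zero Int.cast_one]

/-- A real matrix pushed to `ℂ` is `ofRealHom.mapMatrix`. [folklore] -/
private theorem map_ofReal_eq_mapMatrix_g49g {m : Type*} [Fintype m] [DecidableEq m] (x : Matrix m m ℝ) :
    x.map Complex.ofReal = Complex.ofRealHom.mapMatrix x := rfl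

/-! ## §1 The genericity transfer for the linear sweep `x = A + ᵗA`, `y = B + ᵗB` -/

section Transfer

variable {v : Fin 2 × Fin g × Fin g → ℝ} (j : Matrix (Fin g) (Fin g) ℤ) {α β γ δ : Matrix (Fin g) (Fin g) ℤ}
  {Z : Matrix (Fin g) (Fin g) ℂ}

/-- **Genericity transfer, linear sweep** («`P_z` is generic if and only if `φ(z)` is generic on `V` over
`ℚ`»): put `x = A + ᵗA`, `y = B + ᵗB` with the `2g²` entries of `(A, B)` algebraically independent over `ℚ`
and `Z = (x + jxj) + i(y − jyj)`.  If integer blocks satisfy `(Zβ + δ)Z = Zα + γ` at `Z`, then they satisfy it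
at `Z′ = (x′ + jx′j) + i(y′ − jy′j)`, `x′ = A′ + ᵗA′`, `y′ = B′ + ᵗB′`, for ALL complex `A′`, `B′` (the
relation is a matrix of polynomials over `ℚ̄ ∋ i` vanishing at an algebraically independent point).
[cite: Shimura1972FieldOfRationality, §3 Prop. 11 (ii) and Thm. 2 proof, pp. 175–177] -/
theorem linSweep_rel_forall (hv : AlgebraicIndependent ℚ v)
    (hZ : Z = (Matrix.of fun i k ↦ ((v (0, i, k) : ℝ) : ℂ)) + ((Matrix.of fun i k ↦ ((v (0, i, k) : ℝ) : ℂ)))ᵀ + j.map (Int.cast : ℤ → ℂ) * ((Matrix.of fun i k ↦ ((v (0, i, k) : ℝ) : ℂ)) + ((Matrix.of fun i k ↦ ((v (0, i, k) : ℝ) : ℂ)))ᵀ) * j.map (Int.cast : ℤ → ℂ) +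
        Complex.I • ((Matrix.of fun i k ↦ ((v (1, i, k) : ℝ) : ℂ)) + ((Matrix.of fun i k ↦ ((v (1, i, k) : ℝ) : ℂ)))ᵀ - j.map (Int.cast : ℤ → ℂ) * ((Matrix.of fun i k ↦ ((v (1, i, k) : ℝ) : ℂ)) + ((Matrix.of fun i k ↦ ((v (1, i, k) : ℝ) : ℂ)))ᵀ) * j.map (Int.cast : ℤ → ℂ)))
    (h : (Z * β.map (Int.cast : ℤ → ℂ) + δ.map (Int.cast : ℤ → ℂ)) * Z =
      Z * α.map (Int.cast : ℤ → ℂ) + γ.map (Int.cast : ℤ → ℂ))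
    (A B : Matrix (Fin g) (Fin g) ℂ) {Z' : Matrix (Fin g) (Fin g) ℂ}
    (hZ' : Z' = A + (A)ᵀ + j.map (Int.cast : ℤ → ℂ) * (A + (A)ᵀ) * j.map (Int.cast : ℤ → ℂ) +
        Complex.I • (B + (B)ᵀ - j.map (Int.cast : ℤ → ℂ) * (B + (B)ᵀ) * j.map (Int.cast : ℤ → ℂ))) :
    (Z' * β.map (Int.cast : ℤ → ℂ) + δ.map (Int.cast : ℤ → ℂ)) * Z' =
      Z' * α.map (Int.cast : ℤ → ℂ) + γ.map (Int.cast : ℤ → ℂ) := by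
  classical
  -- scalars: the algebraic closure `ℚ̄` of `ℚ` in `ℂ`, which contains `i`
  have hI : Complex.I ∈ Subalgebra.algebraicClosure ℚ ℂ := by
    rw [Subalgebra.mem_algebraicClosure]
    refine ⟨Polynomial.X ^ 2 + Polynomial.C 1, (Polynomial.monic_X_pow_add_C 1 two_ne_zero).ne_zero, ?_⟩
    simp
  set i₀ : Subalgebra.algebraicClosure ℚ ℂ := ⟨Complex.I, hI⟩ with hi₀
  set w : Fin 2 × Fin g × Fin g → ℂ := fun p ↦ ((v p : ℝ) : ℂ) with hw
  have hwQ : AlgebraicIndependent ℚ w :=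
    hv.map' (f := (Complex.ofRealHom).toRatAlgHom) Complex.ofReal_injective
  have hwQb : AlgebraicIndependent (Subalgebra.algebraicClosure ℚ ℂ) w := hwQ.subalgebraAlgebraicClosure
  have hinj : Function.Injective fun M : Matrix (Fin g) (Fin g)
      (MvPolynomial (Fin 2 × Fin g × Fin g) (Subalgebra.algebraicClosure ℚ ℂ)) ↦ M.map (MvPolynomial.aeval w) :=
    Matrix.map_injective (algebraicIndependent_iff_injective_aeval.1 hwQb)
  -- the complexified linear sweep as a function of the `2g²` complex parameters
  set F : (Fin 2 × Fin g × Fin g → ℂ) → Matrix (Fin g) (Fin g) ℂ := fun u ↦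
    (Matrix.of fun i k ↦ u (0, i, k)) + ((Matrix.of fun i k ↦ u (0, i, k)))ᵀ + j.map (Int.cast : ℤ → ℂ) * ((Matrix.of fun i k ↦ u (0, i, k)) + ((Matrix.of fun i k ↦ u (0, i, k)))ᵀ) * j.map (Int.cast : ℤ → ℂ) +
        Complex.I • ((Matrix.of fun i k ↦ u (1, i, k)) + ((Matrix.of fun i k ↦ u (1, i, k)))ᵀ - j.map (Int.cast : ℤ → ℂ) * ((Matrix.of fun i k ↦ u (1, i, k)) + ((Matrix.of fun i k ↦ u (1, i, k)))ᵀ) * j.map (Int.cast : ℤ → ℂ)) with hF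
  -- generic matrices
  set 𝒜 : Matrix (Fin g) (Fin g) (MvPolynomial (Fin 2 × Fin g × Fin g) (Subalgebra.algebraicClosure ℚ ℂ)) :=
    Matrix.of fun i k ↦ MvPolynomial.X (0, i, k) with h𝒜
  set ℬ : Matrix (Fin g) (Fin g) (MvPolynomial (Fin 2 × Fin g × Fin g) (Subalgebra.algebraicClosure ℚ ℂ)) :=
    Matrix.of fun i k ↦ MvPolynomial.X (1, i, k) with hℬ
  set 𝒥 : Matrix (Fin g) (Fin g) (MvPolynomial (Fin 2 × Fin g × Fin g) (Subalgebra.algebraicClosure ℚ ℂ)) :=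
    j.map (Int.cast : ℤ → _) with h𝒥
  set 𝒟 : Matrix (Fin g) (Fin g) (MvPolynomial (Fin 2 × Fin g × Fin g) (Subalgebra.algebraicClosure ℚ ℂ)) :=
    Matrix.diagonal fun _ ↦ MvPolynomial.C i₀ with h𝒟
  set 𝒵 : Matrix (Fin g) (Fin g) (MvPolynomial (Fin 2 × Fin g × Fin g) (Subalgebra.algebraicClosure ℚ ℂ)) :=
    𝒜 + 𝒜ᵀ + 𝒥 * (𝒜 + 𝒜ᵀ) * 𝒥 + 𝒟 * (ℬ + ℬᵀ - 𝒥 * (ℬ + ℬᵀ) * 𝒥) with h𝒵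
  have hev : ∀ u : Fin 2 × Fin g × Fin g → ℂ, 𝒵.map (MvPolynomial.aeval u) = F u := fun u ↦ by
    have hAu : 𝒜.map (MvPolynomial.aeval u) = Matrix.of fun i k ↦ u (0, i, k) := by
      ext i k
      simp [h𝒜]
    have hBu : ℬ.map (MvPolynomial.aeval u) = Matrix.of fun i k ↦ u (1, i, k) := by
      ext i k
      simp [hℬ]
    have hJu : 𝒥.map (MvPolynomial.aeval u) = j.map (Int.cast : ℤ → ℂ) := map_intCast_map_g49g _ j
    have hDu : 𝒟.map (MvPolynomial.aeval u) = Matrix.diagonal fun _ ↦ Complex.I := by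
      rw [h𝒟, Matrix.diagonal_map (map_zero _)]
      congr 1
      funext
      simp [hi₀]
    rw [h𝒵, ← AlgHom.mapMatrix_apply]
    simp only [map_add, map_sub, map_mul]
    simp only [AlgHom.mapMatrix_apply, Matrix.transpose_map, hAu, hBu, hJu, hDu, ← Matrix.smul_eq_diagonal_mul, hF]
  have hFu : ∀ u : Fin 2 × Fin g × Fin g → ℂ,
      ((𝒵 * β.map (Int.cast : ℤ → MvPolynomial (Fin 2 × Fin g × Fin g) (Subalgebra.algebraicClosure ℚ ℂ)) +
            δ.map (Int.cast : ℤ → _)) * 𝒵 -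
          (𝒵 * α.map (Int.cast : ℤ → _) + γ.map (Int.cast : ℤ → _))).map (MvPolynomial.aeval u) =
        (F u * β.map (Int.cast : ℤ → ℂ) + δ.map (Int.cast : ℤ → ℂ)) * F u -
          (F u * α.map (Int.cast : ℤ → ℂ) + γ.map (Int.cast : ℤ → ℂ)) := fun u ↦ by
    rw [← AlgHom.mapMatrix_apply]
    simp only [map_sub, map_mul, map_add]
    simp only [AlgHom.mapMatrix_apply, hev u, map_intCast_map_g49g]
  have hw0 : F w = Z := by
    rw [hZ]
  have hgen : (𝒵 * β.map (Int.cast : ℤ → MvPolynomial (Fin 2 × Fin g × Fin g) (Subalgebra.algebraicClosure ℚ ℂ)) +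
        δ.map (Int.cast : ℤ → _)) * 𝒵 - (𝒵 * α.map (Int.cast : ℤ → _) + γ.map (Int.cast : ℤ → _)) = 0 := by
    refine hinj ?_
    dsimp only
    rw [hFu, hw0, h, sub_self, Matrix.map_zero _ (map_zero _)]
  set u : Fin 2 × Fin g × Fin g → ℂ := fun p ↦ if p.1 = 0 then A p.2.1 p.2.2 else B p.2.1 p.2.2 with hu
  have hA : (Matrix.of fun i k ↦ u (0, i, k)) = A := by
    ext i k
    simp [hu]
  have hB : (Matrix.of fun i k ↦ u (1, i, k)) = B := by
    ext i k
    simp [hu]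
  have hZu : F u = Z' := by
    rw [hZ']
    simp only [hF, hA, hB]
  have key := hFu u
  rw [hgen, Matrix.map_zero _ (map_zero _), hZu] at key
  exact sub_eq_zero.1 key.symm

end Transfer

/-! ## §2 The tests for the linear sweep -/

section Tests

variable {v : Fin 2 × Fin g × Fin g → ℝ} (j : Matrix (Fin g) (Fin g) ℤ) {α β γ δ : Matrix (Fin g) (Fin g) ℤ}
  {Z : Matrix (Fin g) (Fin g) ℂ}

/-- The complexified linear sweep at `A′ = 0`, `B′ = c·1` is the scalar point `4ic·1` (`c = 0, ±½`:
`Z′ = 0, ±2i`). [cite: Shimura1972FieldOfRationality, §3 Prop. 11 (ii), p. 176] -/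
theorem linSweep_zero_smul_one (hjj : j * j = -1) (c : ℂ) :
    (0 : Matrix (Fin g) (Fin g) ℂ) + ((0 : Matrix (Fin g) (Fin g) ℂ))ᵀ + j.map (Int.cast : ℤ → ℂ) * ((0 : Matrix (Fin g) (Fin g) ℂ) + ((0 : Matrix (Fin g) (Fin g) ℂ))ᵀ) * j.map (Int.cast : ℤ → ℂ) +
        Complex.I • ((c • (1 : Matrix (Fin g) (Fin g) ℂ)) + ((c • (1 : Matrix (Fin g) (Fin g) ℂ)))ᵀ - j.map (Int.cast : ℤ → ℂ) * ((c • (1 : Matrix (Fin g) (Fin g) ℂ)) + ((c • (1 : Matrix (Fin g) (Fin g) ℂ)))ᵀ) * j.map (Int.cast : ℤ → ℂ)) =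
      (4 * Complex.I * c) • (1 : Matrix (Fin g) (Fin g) ℂ) := by
  have hJJ : j.map (Int.cast : ℤ → ℂ) * j.map (Int.cast : ℤ → ℂ) = -1 := map_intCast_mul_self_eq_neg_one_g49g hjj
  have hY : c • (1 : Matrix (Fin g) (Fin g) ℂ) + (c • (1 : Matrix (Fin g) (Fin g) ℂ))ᵀ = (2 * c) • (1 : Matrix (Fin g) (Fin g) ℂ) := by
    rw [Matrix.transpose_smul, Matrix.transpose_one, ← two_smul ℂ, smul_smul]
  have hJYJ : j.map (Int.cast : ℤ → ℂ) * ((2 * c) • (1 : Matrix (Fin g) (Fin g) ℂ)) * j.map (Int.cast : ℤ → ℂ) =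
      -((2 * c) • (1 : Matrix (Fin g) (Fin g) ℂ)) := by
    rw [Matrix.mul_smul, Matrix.mul_one, Matrix.smul_mul, hJJ, smul_neg]
  rw [Matrix.transpose_zero, add_zero, Matrix.mul_zero, Matrix.zero_mul, add_zero, zero_add, hY, hJYJ,
    sub_neg_eq_add, ← two_smul ℂ, smul_smul, smul_smul]
  congr 1
  ring

/-- **The tests, linear sweep**: a period relation `(Zβ + δ)Z = Zα + γ` at the algebraically independent
point forces `β = 0`, `γ = 0`, `α = δ`, and `δS = Sδ` for every symmetric integral `S` with `jSj = S`
(`Z′ = 0, 2i, −2i` and `Z′ = S`). [cite: Shimura1972FieldOfRationality, §3 Thm. 2 proof, pp. 176–177] -/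
theorem blocks_of_linSweep_rel (hv : AlgebraicIndependent ℚ v) (hjj : j * j = -1)
    (hZ : Z = (Matrix.of fun i k ↦ ((v (0, i, k) : ℝ) : ℂ)) + ((Matrix.of fun i k ↦ ((v (0, i, k) : ℝ) : ℂ)))ᵀ + j.map (Int.cast : ℤ → ℂ) * ((Matrix.of fun i k ↦ ((v (0, i, k) : ℝ) : ℂ)) + ((Matrix.of fun i k ↦ ((v (0, i, k) : ℝ) : ℂ)))ᵀ) * j.map (Int.cast : ℤ → ℂ) +
        Complex.I • ((Matrix.of fun i k ↦ ((v (1, i, k) : ℝ) : ℂ)) + ((Matrix.of fun i k ↦ ((v (1, i, k) : ℝ) : ℂ)))ᵀ - j.map (Int.cast : ℤ → ℂ) * ((Matrix.of fun i k ↦ ((v (1, i, k) : ℝ) : ℂ)) + ((Matrix.of fun i k ↦ ((v (1, i, k) : ℝ) : ℂ)))ᵀ) * j.map (Int.cast : ℤ → ℂ)))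
    (h : (Z * β.map (Int.cast : ℤ → ℂ) + δ.map (Int.cast : ℤ → ℂ)) * Z =
      Z * α.map (Int.cast : ℤ → ℂ) + γ.map (Int.cast : ℤ → ℂ)) :
    β = 0 ∧ γ = 0 ∧ α = δ ∧
      ∀ S : Matrix (Fin g) (Fin g) ℤ, Sᵀ = S → j * S * j = S → δ * S = S * δ := by
  have key := linSweep_rel_forall j hv hZ h
  have hsc := linSweep_zero_smul_one j hjj
  -- `Z′ = 0`: `γ = 0`
  have h0 := key 0 ((0 : ℂ) • 1) (Z' := 0) (by rw [hsc]; simp)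
  rw [Matrix.mul_zero, Matrix.zero_mul, zero_add] at h0
  have hγ : γ = 0 := by
    apply map_intCast_injective_g49g (R := ℂ)
    dsimp only
    rw [← h0, Matrix.map_zero _ Int.cast_zero]
  subst hγ
  -- `Z′ = 2i·1` and `Z′ = −2i·1`: `β = 0`, `α = δ`
  have h1 := key 0 ((2⁻¹ : ℂ) • 1) (Z' := (2 * Complex.I) • 1) (by rw [hsc]; congr 1; ring)
  have h2 := key 0 ((-2⁻¹ : ℂ) • 1) (Z' := (-(2 * Complex.I)) • 1) (by rw [hsc]; congr 1; ring)
  rw [Matrix.smul_mul, Matrix.one_mul, Matrix.mul_smul, Matrix.mul_one] at h1 h2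
  have e1 : ∀ i k, 2 * Complex.I * (2 * Complex.I * (β i k : ℂ) + δ i k) = 2 * Complex.I * α i k := fun i k ↦ by
    have := congrFun (congrFun h1 i) k
    simpa [Matrix.map_apply] using this
  have e2 : ∀ i k, -(2 * Complex.I) * (-(2 * Complex.I) * (β i k : ℂ) + δ i k) = -(2 * Complex.I) * α i k :=
    fun i k ↦ by
    have := congrFun (congrFun h2 i) k
    simpa [Matrix.map_apply] using this
  have hβik : ∀ i k, (β i k : ℂ) = 0 := fun i k ↦ by
    linear_combination (-(1 : ℂ) / 8) * (e1 i k + e2 i k) + (β i k : ℂ) * Complex.I_mul_I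
  have hβ : β = 0 := by
    ext i k
    exact_mod_cast hβik i k
  have h2I : (2 * Complex.I) ≠ 0 := mul_ne_zero two_ne_zero Complex.I_ne_zero
  have hαδ : α = δ := by
    ext i k
    have := e1 i k
    rw [hβik, mul_zero, zero_add] at this
    exact_mod_cast (mul_left_cancel₀ h2I this).symm
  subst hβ hαδ
  refine ⟨rfl, rfl, rfl, fun S hST hSj ↦ ?_⟩
  -- `Z′ = S`: `A′ = S/4`, `B′ = 0`
  have hScT : (S.map (Int.cast : ℤ → ℂ))ᵀ = S.map (Int.cast : ℤ → ℂ) := by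
    rw [← Matrix.transpose_map, hST]
  have hSjc : j.map (Int.cast : ℤ → ℂ) * S.map (Int.cast : ℤ → ℂ) * j.map (Int.cast : ℤ → ℂ) =
      S.map (Int.cast : ℤ → ℂ) := by
    rw [← map_intCast_mul_g49g, ← map_intCast_mul_g49g, hSj]
  have hS : S.map (Int.cast : ℤ → ℂ) =
      ((4⁻¹ : ℂ) • S.map (Int.cast : ℤ → ℂ)) + (((4⁻¹ : ℂ) • S.map (Int.cast : ℤ → ℂ)))ᵀ + j.map (Int.cast : ℤ → ℂ) * (((4⁻¹ : ℂ) • S.map (Int.cast : ℤ → ℂ)) + (((4⁻¹ : ℂ) • S.map (Int.cast : ℤ → ℂ)))ᵀ) * j.map (Int.cast : ℤ → ℂ) +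
        Complex.I • ((0 : Matrix (Fin g) (Fin g) ℂ) + ((0 : Matrix (Fin g) (Fin g) ℂ))ᵀ - j.map (Int.cast : ℤ → ℂ) * ((0 : Matrix (Fin g) (Fin g) ℂ) + ((0 : Matrix (Fin g) (Fin g) ℂ))ᵀ) * j.map (Int.cast : ℤ → ℂ)) := by
    rw [Matrix.transpose_zero, add_zero, Matrix.mul_zero, Matrix.zero_mul, sub_zero, smul_zero, add_zero,
      Matrix.transpose_smul, hScT, ← add_smul, Matrix.mul_smul, Matrix.smul_mul, hSjc, ← add_smul]
    norm_num
  have h3 := key _ _ hS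
  rw [Matrix.map_zero _ Int.cast_zero, Matrix.mul_zero, zero_add, add_zero] at h3
  apply map_intCast_injective_g49g (R := ℂ)
  dsimp only
  rw [map_intCast_mul_g49g, map_intCast_mul_g49g]
  exact h3

end Tests

/-! ## §3 Thm. 2 at the point of the linear sweep with algebraically independent coordinates -/

section Point

variable (hδ : ∀ i, 0 < (1 : Fin g → ℕ) i) (j : Matrix (Fin g) (Fin g) ℤ) (v : Fin 2 × Fin g × Fin g → ℝ)
  {Z : Matrix (Fin g) (Fin g) ℂ}

/-- The real point of the linear sweep in cast form. [folklore] -/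
private theorem linSweepPoint_cast_g49g :
    (Matrix.of fun i k ↦ ((v (0, i, k) : ℝ) : ℂ)) + (Matrix.of fun i k ↦ ((v (0, i, k) : ℝ) : ℂ))ᵀ = ((Matrix.of fun i k ↦ v (0, i, k)) + (Matrix.of fun i k ↦ v (0, i, k))ᵀ).map Complex.ofReal ∧
      (Matrix.of fun i k ↦ ((v (1, i, k) : ℝ) : ℂ)) + (Matrix.of fun i k ↦ ((v (1, i, k) : ℝ) : ℂ))ᵀ = ((Matrix.of fun i k ↦ v (1, i, k)) + (Matrix.of fun i k ↦ v (1, i, k))ᵀ).map Complex.ofReal := by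
  have ha : (Matrix.of fun i k ↦ ((v (0, i, k) : ℝ) : ℂ)) = (Matrix.of fun i k ↦ v (0, i, k)).map Complex.ofReal := rfl
  have hb : (Matrix.of fun i k ↦ ((v (1, i, k) : ℝ) : ℂ)) = (Matrix.of fun i k ↦ v (1, i, k)).map Complex.ofReal := rfl
  constructor
  · rw [ha, map_ofReal_eq_mapMatrix_g49g (_ + _), map_add, RingHom.mapMatrix_apply, RingHom.mapMatrix_apply,
      Matrix.transpose_map]
    rfl
  · rw [hb, map_ofReal_eq_mapMatrix_g49g (_ + _), map_add, RingHom.mapMatrix_apply, RingHom.mapMatrix_apply,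
      Matrix.transpose_map]
    rfl

/-- **The point of the linear sweep is symmetric** for every real `v` (`ᵗj = −j`). [cite: Shimura1972FieldOfRationality, §3 Prop. 11 (the shape of `𝔜`), pp. 175–176] -/
theorem linSweepPoint_transpose (hjT : jᵀ = -j)
    (hZ : Z = (Matrix.of fun i k ↦ ((v (0, i, k) : ℝ) : ℂ)) + ((Matrix.of fun i k ↦ ((v (0, i, k) : ℝ) : ℂ)))ᵀ + j.map (Int.cast : ℤ → ℂ) * ((Matrix.of fun i k ↦ ((v (0, i, k) : ℝ) : ℂ)) + ((Matrix.of fun i k ↦ ((v (0, i, k) : ℝ) : ℂ)))ᵀ) * j.map (Int.cast : ℤ → ℂ) +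
        Complex.I • ((Matrix.of fun i k ↦ ((v (1, i, k) : ℝ) : ℂ)) + ((Matrix.of fun i k ↦ ((v (1, i, k) : ℝ) : ℂ)))ᵀ - j.map (Int.cast : ℤ → ℂ) * ((Matrix.of fun i k ↦ ((v (1, i, k) : ℝ) : ℂ)) + ((Matrix.of fun i k ↦ ((v (1, i, k) : ℝ) : ℂ)))ᵀ) * j.map (Int.cast : ℤ → ℂ))) :
    Zᵀ = Z :=
  sweep_transpose j hjT (by rw [Matrix.transpose_add, Matrix.transpose_transpose, add_comm])
    (by rw [Matrix.transpose_add, Matrix.transpose_transpose, add_comm]) hZ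

/-- **The point lies on `𝔜_j`**: `jZ = −Z̄j` (`j² = −1`). [cite: Shimura1972FieldOfRationality, §3 Prop. 11 («Conversely, such a `z` … belongs to `𝔜`»), pp. 175–176] -/
theorem linSweepPoint_rel (hjj : j * j = -1)
    (hZ : Z = (Matrix.of fun i k ↦ ((v (0, i, k) : ℝ) : ℂ)) + ((Matrix.of fun i k ↦ ((v (0, i, k) : ℝ) : ℂ)))ᵀ + j.map (Int.cast : ℤ → ℂ) * ((Matrix.of fun i k ↦ ((v (0, i, k) : ℝ) : ℂ)) + ((Matrix.of fun i k ↦ ((v (0, i, k) : ℝ) : ℂ)))ᵀ) * j.map (Int.cast : ℤ → ℂ) +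
        Complex.I • ((Matrix.of fun i k ↦ ((v (1, i, k) : ℝ) : ℂ)) + ((Matrix.of fun i k ↦ ((v (1, i, k) : ℝ) : ℂ)))ᵀ - j.map (Int.cast : ℤ → ℂ) * ((Matrix.of fun i k ↦ ((v (1, i, k) : ℝ) : ℂ)) + ((Matrix.of fun i k ↦ ((v (1, i, k) : ℝ) : ℂ)))ᵀ) * j.map (Int.cast : ℤ → ℂ))) :
    j.map (Int.cast : ℤ → ℂ) * Z = -Z.map conj * j.map (Int.cast : ℤ → ℂ) := by
  obtain ⟨hx, hy⟩ := linSweepPoint_cast_g49g v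
  rw [hx, hy] at hZ
  refine sweep_rel j hjj ?_ ?_ hZ
  · ext i k
    simp [Matrix.map_apply]
  · ext i k
    simp [Matrix.map_apply]

variable {v} (hZ𝔥 : Z ∈ siegelUpperHalfSpace g)

/-- **`End(X_Z) = ℤ` at the generic point of the linear sweep** (`Z ∈ 𝔥_g`, `j² = −1`, `ᵗj = −j`, the
entries of `(A, B)` algebraically independent): every integral matrix commuting with `J_Z` is `c·1`.
[cite: Shimura1972FieldOfRationality, §3 Thm. 2 and its proof, pp. 176–177] -/
theorem linSweepPoint_end_eq_smul_one (hg : 0 < g) (hjj : j * j = -1) (hjT : jᵀ = -j)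
    (hv : AlgebraicIndependent ℚ v)
    (hZ : Z = (Matrix.of fun i k ↦ ((v (0, i, k) : ℝ) : ℂ)) + ((Matrix.of fun i k ↦ ((v (0, i, k) : ℝ) : ℂ)))ᵀ + j.map (Int.cast : ℤ → ℂ) * ((Matrix.of fun i k ↦ ((v (0, i, k) : ℝ) : ℂ)) + ((Matrix.of fun i k ↦ ((v (0, i, k) : ℝ) : ℂ)))ᵀ) * j.map (Int.cast : ℤ → ℂ) +
        Complex.I • ((Matrix.of fun i k ↦ ((v (1, i, k) : ℝ) : ℂ)) + ((Matrix.of fun i k ↦ ((v (1, i, k) : ℝ) : ℂ)))ᵀ - j.map (Int.cast : ℤ → ℂ) * ((Matrix.of fun i k ↦ ((v (1, i, k) : ℝ) : ℂ)) + ((Matrix.of fun i k ↦ ((v (1, i, k) : ℝ) : ℂ)))ᵀ) * j.map (Int.cast : ℤ → ℂ)))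
    {M : Matrix (Fin g ⊕ Fin g) (Fin g ⊕ Fin g) ℤ}
    (hM : ∀ x, (M.map (Int.cast : ℤ → ℝ)) *ᵥ latticeJ (siegelPeriodEquiv hδ hZ𝔥) x =
      latticeJ (siegelPeriodEquiv hδ hZ𝔥) ((M.map (Int.cast : ℤ → ℝ)) *ᵥ x)) :
    ∃ c : ℤ, M = c • 1 := by
  obtain ⟨α, β, γ, δ, hMb, hrel⟩ := exists_blocks_rel_of_mulVec_latticeJ hδ hZ𝔥 hM
  obtain ⟨hβ, hγ, hαδ, hcomm⟩ := blocks_of_linSweep_rel j hv hjj hZ hrel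
  obtain ⟨c, hc⟩ := exists_eq_smul_one_of_forall_symm_locus_comm hg hjj hjT hcomm
  refine ⟨c, ?_⟩
  rw [hMb, hβ, hγ, hαδ, hc, ← Matrix.fromBlocks_one, Matrix.fromBlocks_smul, smul_zero]

/-- **`End(X_Z)^* = {±1}`** at the generic point of the linear sweep. [cite: Shimura1972FieldOfRationality, §3 Prop. 12 (hypothesis) and Thm. 2 proof, pp. 176–177] -/
theorem linSweepPoint_end_units (hg : 0 < g) (hjj : j * j = -1) (hjT : jᵀ = -j)
    (hv : AlgebraicIndependent ℚ v)
    (hZ : Z = (Matrix.of fun i k ↦ ((v (0, i, k) : ℝ) : ℂ)) + ((Matrix.of fun i k ↦ ((v (0, i, k) : ℝ) : ℂ)))ᵀ + j.map (Int.cast : ℤ → ℂ) * ((Matrix.of fun i k ↦ ((v (0, i, k) : ℝ) : ℂ)) + ((Matrix.of fun i k ↦ ((v (0, i, k) : ℝ) : ℂ)))ᵀ) * j.map (Int.cast : ℤ → ℂ) +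
        Complex.I • ((Matrix.of fun i k ↦ ((v (1, i, k) : ℝ) : ℂ)) + ((Matrix.of fun i k ↦ ((v (1, i, k) : ℝ) : ℂ)))ᵀ - j.map (Int.cast : ℤ → ℂ) * ((Matrix.of fun i k ↦ ((v (1, i, k) : ℝ) : ℂ)) + ((Matrix.of fun i k ↦ ((v (1, i, k) : ℝ) : ℂ)))ᵀ) * j.map (Int.cast : ℤ → ℂ)))
    (P : Matrix (Fin g ⊕ Fin g) (Fin g ⊕ Fin g) ℤ)
    (hP : MDifferentiable 𝓘(ℂ, Fin g → ℂ) 𝓘(ℂ, Fin g → ℂ)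
      (mapMatrix (siegelPeriodEquiv hδ hZ𝔥) (siegelPeriodEquiv hδ hZ𝔥) P))
    (hPQ : ∃ Q : Matrix (Fin g ⊕ Fin g) (Fin g ⊕ Fin g) ℤ, P * Q = 1 ∧ Q * P = 1) :
    P = 1 ∨ P = -1 := by
  obtain ⟨Q, hPQ, -⟩ := hPQ
  obtain ⟨c, hc⟩ := linSweepPoint_end_eq_smul_one hδ j hZ𝔥 hg hjj hjT hv hZ
    (mulVec_latticeJ_comm_of_mdifferentiable hP)
  rw [hc, Matrix.smul_mul, Matrix.one_mul] at hPQ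
  set i₀ : Fin g ⊕ Fin g := Sum.inl ⟨0, hg⟩ with hi₀
  have hcq : c * Q i₀ i₀ = 1 := by
    have e := congrFun (congrFun hPQ i₀) i₀
    simpa using e
  rcases Int.eq_one_or_neg_one_of_mul_eq_one hcq with h1 | h1
  · left
    rw [hc, h1, one_smul]
  · right
    rw [hc, h1, neg_smul, one_smul]

/-- **Thm. 2 at the generic point of the linear sweep**: `(X_Z, E_Z) ≅ (X_{−Z̄}, E_{−Z̄})` as principally
polarized tori, `X_Z ≅` every conjugate presentation, `End(X_Z) = ℤ`, and `X_Z` has NO real structure.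
[cite: Shimura1972FieldOfRationality, §3 Prop. 10, Prop. 12 and Thm. 2, pp. 174–177] -/
theorem linSweepPoint_isPolarizedIso_conj_and_isEmpty_realStructure (hg : 0 < g) (hjj : j * j = -1)
    (hjT : jᵀ = -j) (hv : AlgebraicIndependent ℚ v)
    (hZ : Z = (Matrix.of fun i k ↦ ((v (0, i, k) : ℝ) : ℂ)) + ((Matrix.of fun i k ↦ ((v (0, i, k) : ℝ) : ℂ)))ᵀ + j.map (Int.cast : ℤ → ℂ) * ((Matrix.of fun i k ↦ ((v (0, i, k) : ℝ) : ℂ)) + ((Matrix.of fun i k ↦ ((v (0, i, k) : ℝ) : ℂ)))ᵀ) * j.map (Int.cast : ℤ → ℂ) +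
        Complex.I • ((Matrix.of fun i k ↦ ((v (1, i, k) : ℝ) : ℂ)) + ((Matrix.of fun i k ↦ ((v (1, i, k) : ℝ) : ℂ)))ᵀ - j.map (Int.cast : ℤ → ℂ) * ((Matrix.of fun i k ↦ ((v (1, i, k) : ℝ) : ℂ)) + ((Matrix.of fun i k ↦ ((v (1, i, k) : ℝ) : ℂ)))ᵀ) * j.map (Int.cast : ℤ → ℂ))) :
    (∃ h : ComplexTorus (siegelPeriodEquiv hδ hZ𝔥) ≃+
        ComplexTorus (siegelPeriodEquiv hδ (neg_map_conj_mem_siegelUpperHalfSpace hZ𝔥)),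
      IsPolarizedIso (siegelPeriodEquiv hδ hZ𝔥) (siegelForm hδ hZ𝔥)
        (siegelPeriodEquiv hδ (neg_map_conj_mem_siegelUpperHalfSpace hZ𝔥))
        (siegelForm hδ (neg_map_conj_mem_siegelUpperHalfSpace hZ𝔥)) h) ∧
    (∀ {Ec : Type} [NormedAddCommGroup Ec] [NormedSpace ℂ Ec] (Ψc : (Fin g ⊕ Fin g → ℝ) ≃L[ℝ] Ec),
        (∀ w, latticeJ Ψc w = -latticeJ (siegelPeriodEquiv hδ hZ𝔥) w) →
          IsIsomorphic (siegelPeriodEquiv hδ hZ𝔥) Ψc) ∧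
    (∀ M : Matrix (Fin g ⊕ Fin g) (Fin g ⊕ Fin g) ℤ,
        (∀ x, (M.map (Int.cast : ℤ → ℝ)) *ᵥ latticeJ (siegelPeriodEquiv hδ hZ𝔥) x =
          latticeJ (siegelPeriodEquiv hδ hZ𝔥) ((M.map (Int.cast : ℤ → ℝ)) *ᵥ x)) → ∃ c : ℤ, M = c • 1) ∧
    IsEmpty (RealStructure 𝓘(ℂ, Fin g → ℂ) (ComplexTorus (siegelPeriodEquiv hδ hZ𝔥))) := by
  have hjT1 : jᵀ * j = 1 := transpose_mul_self_eq_one_of_locusJ hjj hjT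
  have hjZ := linSweepPoint_rel j v hjj hZ
  obtain ⟨h, hh, -, -⟩ := exists_isPolarizedIso_blockDiag hδ hZ𝔥 (neg_map_conj_mem_siegelUpperHalfSpace hZ𝔥) j
    hjT1 hjZ
  obtain ⟨hiso, hempty⟩ := isIsomorphic_conj_and_isEmpty_realStructure_of_blockRel hδ hZ𝔥 j hg hjj hjZ
    (linSweepPoint_end_units hδ j hZ𝔥 hg hjj hjT hv hZ)
  exact ⟨⟨h, hh⟩, hiso, fun M hM ↦ linSweepPoint_end_eq_smul_one hδ j hZ𝔥 hg hjj hjT hv hZ hM, hempty⟩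

end Point

/-! ## §4 The linear sweep is continuous and onto `𝔥_g ∩ 𝔜_j` -/

section Onto

variable (j : Matrix (Fin g) (Fin g) ℤ) {Z : Matrix (Fin g) (Fin g) ℂ}

/-- **Every point of `𝔥_g ∩ 𝔜_j` is a point of the linear sweep**: `Z = Z_L(A, B)` with `A = Re Z/4`,
`B = Im Z/4` real (g49-#1 `exists_sweep_eq_of_locus`: `Z = Z(Re Z/2, Im Z/2)`). [cite: Shimura1972FieldOfRationality, §3 Prop. 11 («every point `z` of `𝔜` can be written in the form …»), pp. 175–176] -/
theorem exists_linSweepPoint_eq_of_locus (hjj : j * j = -1) (hZ𝔥 : Z ∈ siegelUpperHalfSpace g)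
    (hjZ : j.map (Int.cast : ℤ → ℂ) * Z = -Z.map conj * j.map (Int.cast : ℤ → ℂ)) :
    ∃ v : Fin 2 × Fin g × Fin g → ℝ,
      Z = (Matrix.of fun i k ↦ ((v (0, i, k) : ℝ) : ℂ)) + ((Matrix.of fun i k ↦ ((v (0, i, k) : ℝ) : ℂ)))ᵀ + j.map (Int.cast : ℤ → ℂ) * ((Matrix.of fun i k ↦ ((v (0, i, k) : ℝ) : ℂ)) + ((Matrix.of fun i k ↦ ((v (0, i, k) : ℝ) : ℂ)))ᵀ) * j.map (Int.cast : ℤ → ℂ) +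
        Complex.I • ((Matrix.of fun i k ↦ ((v (1, i, k) : ℝ) : ℂ)) + ((Matrix.of fun i k ↦ ((v (1, i, k) : ℝ) : ℂ)))ᵀ - j.map (Int.cast : ℤ → ℂ) * ((Matrix.of fun i k ↦ ((v (1, i, k) : ℝ) : ℂ)) + ((Matrix.of fun i k ↦ ((v (1, i, k) : ℝ) : ℂ)))ᵀ) * j.map (Int.cast : ℤ → ℂ)) := by
  obtain ⟨x, y, hxT, hyT, -, hZ⟩ := exists_sweep_eq_of_locus j hjj hZ𝔥 hjZ
  refine ⟨fun p ↦ if p.1 = 0 then (2⁻¹ : ℝ) * x p.2.1 p.2.2 else (2⁻¹ : ℝ) * y p.2.1 p.2.2, ?_⟩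
  have hA : (Matrix.of fun i k ↦ (((fun p : Fin 2 × Fin g × Fin g ↦
      if p.1 = 0 then (2⁻¹ : ℝ) * x p.2.1 p.2.2 else (2⁻¹ : ℝ) * y p.2.1 p.2.2) (0, i, k) : ℝ) : ℂ)) +
      (Matrix.of fun i k ↦ (((fun p : Fin 2 × Fin g × Fin g ↦
        if p.1 = 0 then (2⁻¹ : ℝ) * x p.2.1 p.2.2 else (2⁻¹ : ℝ) * y p.2.1 p.2.2) (0, i, k) : ℝ) : ℂ))ᵀ =
      x.map Complex.ofReal := by
    ext i k
    have hx : x k i = x i k := by rw [← Matrix.transpose_apply x i k, hxT]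
    simp only [Matrix.add_apply, Matrix.of_apply, Matrix.transpose_apply, Matrix.map_apply, hx]
    push_cast
    ring
  have hB : (Matrix.of fun i k ↦ (((fun p : Fin 2 × Fin g × Fin g ↦
      if p.1 = 0 then (2⁻¹ : ℝ) * x p.2.1 p.2.2 else (2⁻¹ : ℝ) * y p.2.1 p.2.2) (1, i, k) : ℝ) : ℂ)) +
      (Matrix.of fun i k ↦ (((fun p : Fin 2 × Fin g × Fin g ↦
        if p.1 = 0 then (2⁻¹ : ℝ) * x p.2.1 p.2.2 else (2⁻¹ : ℝ) * y p.2.1 p.2.2) (1, i, k) : ℝ) : ℂ))ᵀ =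
      y.map Complex.ofReal := by
    ext i k
    have hy : y k i = y i k := by rw [← Matrix.transpose_apply y i k, hyT]
    simp only [Matrix.add_apply, Matrix.of_apply, Matrix.transpose_apply, Matrix.map_apply,
      if_neg (show (1 : Fin 2) ≠ 0 from one_ne_zero), hy]
    push_cast
    ring
  rw [hA, hB]
  exact hZ

/-- **The linear sweep is continuous** in the `2g²` real parameters. [cite: Shimura1972FieldOfRationality, §3 Prop. 11 (the real coordinates `x, y, r, s` of `𝔜`), pp. 175–176] -/
theorem continuous_linSweepPoint :
    Continuous fun v : Fin 2 × Fin g × Fin g → ℝ ↦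
      (Matrix.of fun i k ↦ ((v (0, i, k) : ℝ) : ℂ)) + ((Matrix.of fun i k ↦ ((v (0, i, k) : ℝ) : ℂ)))ᵀ + j.map (Int.cast : ℤ → ℂ) * ((Matrix.of fun i k ↦ ((v (0, i, k) : ℝ) : ℂ)) + ((Matrix.of fun i k ↦ ((v (0, i, k) : ℝ) : ℂ)))ᵀ) * j.map (Int.cast : ℤ → ℂ) +
        Complex.I • ((Matrix.of fun i k ↦ ((v (1, i, k) : ℝ) : ℂ)) + ((Matrix.of fun i k ↦ ((v (1, i, k) : ℝ) : ℂ)))ᵀ - j.map (Int.cast : ℤ → ℂ) * ((Matrix.of fun i k ↦ ((v (1, i, k) : ℝ) : ℂ)) + ((Matrix.of fun i k ↦ ((v (1, i, k) : ℝ) : ℂ)))ᵀ) * j.map (Int.cast : ℤ → ℂ)) := by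
  have hA : Continuous fun v : Fin 2 × Fin g × Fin g → ℝ ↦ (Matrix.of fun i k ↦ ((v (0, i, k) : ℝ) : ℂ)) :=
    continuous_matrix fun i k ↦ Complex.continuous_ofReal.comp (continuous_apply _)
  have hB : Continuous fun v : Fin 2 × Fin g × Fin g → ℝ ↦ (Matrix.of fun i k ↦ ((v (1, i, k) : ℝ) : ℂ)) :=
    continuous_matrix fun i k ↦ Complex.continuous_ofReal.comp (continuous_apply _)
  have hx : Continuous fun v : Fin 2 × Fin g × Fin g → ℝ ↦
      (Matrix.of fun i k ↦ ((v (0, i, k) : ℝ) : ℂ)) + ((Matrix.of fun i k ↦ ((v (0, i, k) : ℝ) : ℂ)))ᵀ :=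
    hA.add hA.matrix_transpose
  have hy : Continuous fun v : Fin 2 × Fin g × Fin g → ℝ ↦
      (Matrix.of fun i k ↦ ((v (1, i, k) : ℝ) : ℂ)) + ((Matrix.of fun i k ↦ ((v (1, i, k) : ℝ) : ℂ)))ᵀ :=
    hB.add hB.matrix_transpose
  have hx2 : Continuous fun v : Fin 2 × Fin g × Fin g → ℝ ↦
      (Matrix.of fun i k ↦ ((v (0, i, k) : ℝ) : ℂ)) + ((Matrix.of fun i k ↦ ((v (0, i, k) : ℝ) : ℂ)))ᵀ + j.map (Int.cast : ℤ → ℂ) * ((Matrix.of fun i k ↦ ((v (0, i, k) : ℝ) : ℂ)) + ((Matrix.of fun i k ↦ ((v (0, i, k) : ℝ) : ℂ)))ᵀ) * j.map (Int.cast : ℤ → ℂ) :=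
    hx.add ((continuous_const.matrix_mul hx).matrix_mul continuous_const)
  have hy2 : Continuous fun v : Fin 2 × Fin g × Fin g → ℝ ↦
      (Matrix.of fun i k ↦ ((v (1, i, k) : ℝ) : ℂ)) + ((Matrix.of fun i k ↦ ((v (1, i, k) : ℝ) : ℂ)))ᵀ - j.map (Int.cast : ℤ → ℂ) * ((Matrix.of fun i k ↦ ((v (1, i, k) : ℝ) : ℂ)) + ((Matrix.of fun i k ↦ ((v (1, i, k) : ℝ) : ℂ)))ᵀ) * j.map (Int.cast : ℤ → ℂ) :=
    hy.sub ((continuous_const.matrix_mul hy).matrix_mul continuous_const)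
  have hy3 : Continuous fun v : Fin 2 × Fin g × Fin g → ℝ ↦
      Complex.I • ((Matrix.of fun i k ↦ ((v (1, i, k) : ℝ) : ℂ)) + ((Matrix.of fun i k ↦ ((v (1, i, k) : ℝ) : ℂ)))ᵀ - j.map (Int.cast : ℤ → ℂ) * ((Matrix.of fun i k ↦ ((v (1, i, k) : ℝ) : ℂ)) + ((Matrix.of fun i k ↦ ((v (1, i, k) : ℝ) : ℂ)))ᵀ) * j.map (Int.cast : ℤ → ℂ)) :=
    hy2.const_smul Complex.I
  exact hx2.add hy3

end Onto

/-! ## §5 «`𝔜` cannot be covered by `∪_{f ∈ S′} X_f`»: the generic points are dense in `𝔥_g ∩ 𝔜_j` -/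

section Dense

variable (hδ : ∀ i, 0 < (1 : Fin g → ℕ) i) {j : Matrix (Fin g) (Fin g) ℤ}

/-- **THEOREM 2 ON THE LOCUS (the Baire form of Shimura's proof).**  For every integral `j` with `j² = −1`,
`ᵗj = −j` (`g ≥ 1`): every point of `𝔥_g ∩ 𝔜_j` is a limit of points `Z ∈ 𝔥_g ∩ 𝔜_j` whose principally
polarized torus `(X_Z, E_Z)` is isomorphic to its conjugate `(X_{−Z̄}, E_{−Z̄})`, has `End(X_Z) = ℤ`, and
admits NO real structure — the set of such `Z` is dense in `𝔥_g ∩ 𝔜_j` («`X_f` is a closed subset of `𝔜`,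
which contains no non-empty open subset of `𝔜` … `𝔜` cannot be covered by `∪_{f ∈ S′} X_f`»).
[cite: Shimura1972FieldOfRationality, §3 Prop. 11 and Thm. 2 with its proof, pp. 175–177] -/
theorem locus_subset_closure_generic (hg : 0 < g) (hjj : j * j = -1) (hjT : jᵀ = -j) :
    siegelUpperHalfSpace g ∩
        {Z : Matrix (Fin g) (Fin g) ℂ | j.map (Int.cast : ℤ → ℂ) * Z = -Z.map conj * j.map (Int.cast : ℤ → ℂ)} ⊆
      closure {Z : Matrix (Fin g) (Fin g) ℂ | ∃ hZ : Z ∈ siegelUpperHalfSpace g,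
        j.map (Int.cast : ℤ → ℂ) * Z = -Z.map conj * j.map (Int.cast : ℤ → ℂ) ∧
        (∃ h : ComplexTorus (siegelPeriodEquiv hδ hZ) ≃+
            ComplexTorus (siegelPeriodEquiv hδ (neg_map_conj_mem_siegelUpperHalfSpace hZ)),
          IsPolarizedIso (siegelPeriodEquiv hδ hZ) (siegelForm hδ hZ)
            (siegelPeriodEquiv hδ (neg_map_conj_mem_siegelUpperHalfSpace hZ))
            (siegelForm hδ (neg_map_conj_mem_siegelUpperHalfSpace hZ)) h) ∧
        (∀ M : Matrix (Fin g ⊕ Fin g) (Fin g ⊕ Fin g) ℤ,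
            (∀ x, (M.map (Int.cast : ℤ → ℝ)) *ᵥ latticeJ (siegelPeriodEquiv hδ hZ) x =
              latticeJ (siegelPeriodEquiv hδ hZ) ((M.map (Int.cast : ℤ → ℝ)) *ᵥ x)) → ∃ c : ℤ, M = c • 1) ∧
        IsEmpty (RealStructure 𝓘(ℂ, Fin g → ℂ) (ComplexTorus (siegelPeriodEquiv hδ hZ)))} := by
  intro Z₀ hZ₀
  obtain ⟨hZ₀𝔥, hjZ₀⟩ := hZ₀
  -- the sweep map and a parameter of `Z₀`
  set Ψ : (Fin 2 × Fin g × Fin g → ℝ) → Matrix (Fin g) (Fin g) ℂ := fun v ↦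
      (Matrix.of fun i k ↦ ((v (0, i, k) : ℝ) : ℂ)) + ((Matrix.of fun i k ↦ ((v (0, i, k) : ℝ) : ℂ)))ᵀ + j.map (Int.cast : ℤ → ℂ) * ((Matrix.of fun i k ↦ ((v (0, i, k) : ℝ) : ℂ)) + ((Matrix.of fun i k ↦ ((v (0, i, k) : ℝ) : ℂ)))ᵀ) * j.map (Int.cast : ℤ → ℂ) +
        Complex.I • ((Matrix.of fun i k ↦ ((v (1, i, k) : ℝ) : ℂ)) + ((Matrix.of fun i k ↦ ((v (1, i, k) : ℝ) : ℂ)))ᵀ - j.map (Int.cast : ℤ → ℂ) * ((Matrix.of fun i k ↦ ((v (1, i, k) : ℝ) : ℂ)) + ((Matrix.of fun i k ↦ ((v (1, i, k) : ℝ) : ℂ)))ᵀ) * j.map (Int.cast : ℤ → ℂ))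
    with hΨ
  have hΨc : Continuous Ψ := continuous_linSweepPoint j
  obtain ⟨v₀, hv₀⟩ := exists_linSweepPoint_eq_of_locus j hjj hZ₀𝔥 hjZ₀
  have hΨv₀ : Ψ v₀ = Z₀ := hv₀.symm
  -- positivity of `Im Ψ(v)` is an open condition, satisfied at `v₀`
  set U : Set (Fin 2 × Fin g × Fin g → ℝ) :=
    Ψ ⁻¹' {Z : Matrix (Fin g) (Fin g) ℂ | ∀ w : Fin g → ℝ, w ≠ 0 → 0 < w ⬝ᵥ Z.map Complex.im *ᵥ w} with hU
  have hUo : IsOpen U := isOpen_setOf_im_pos.preimage hΨc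
  have hv₀U : v₀ ∈ U := by
    rw [hU, Set.mem_preimage, hΨv₀]
    rw [siegelUpperHalfSpace_eq_inter] at hZ₀𝔥
    exact hZ₀𝔥.2
  have hU𝔥 : ∀ v ∈ U, Ψ v ∈ siegelUpperHalfSpace g := fun v hv ↦ by
    rw [siegelUpperHalfSpace_eq_inter]
    exact ⟨linSweepPoint_transpose j v hjT rfl, hv⟩
  -- the algebraically independent parameters accumulate at `v₀` inside `U`
  have hcl : v₀ ∈ closure (U ∩ {v : Fin 2 × Fin g × Fin g → ℝ | AlgebraicIndependent ℚ v}) :=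
    dense_setOf_algebraicIndependent.open_subset_closure_inter hUo hv₀U
  rw [← hΨv₀]
  refine map_mem_closure hΨc hcl fun v hv ↦ ?_
  obtain ⟨hvU, hv⟩ := hv
  have hZ𝔥 : Ψ v ∈ siegelUpperHalfSpace g := hU𝔥 v hvU
  obtain ⟨hpol, -, hend, hempty⟩ :=
    linSweepPoint_isPolarizedIso_conj_and_isEmpty_realStructure hδ j hZ𝔥 hg hjj hjT hv rfl
  exact ⟨hZ𝔥, linSweepPoint_rel j v hjj rfl, hpol, hend, hempty⟩

end Dense

end SiegelModuli

end Literature.AlgebraicGeometry.ModuliOfAbelianVarieties
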